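import Mathlib
import Summits.NavierStokesRegularity.NavierStokesRegularity.Theorems.ThreadingFluxHorizonTowerCubicIdentification
import HarnessLib

/-!
# Crux `PoloidalLiouville` (stmt-NavierStokesRegularity-1222, wall W1), crux idea «horizon-threading-tower» (ns-idea-15):
# `HorizonZonalitySingleDegree` REDUCED BY NAME to the first-order algebraic statement «`det(∇H, ∇|∇H|², x) ≡ 0` off the origin
# ⇒ `H` zonal», and the table cell `HorizonL2Tetrahedral` by name

Support file (Theorems-side tooling; seat ns-wall-eng-4 g2, cell ns-wall-extremal, W1 adjunct; `--supports stmt-NavierStokesRegularity-1222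
--as helper`).  Consequences of the closed-form law `HorizonTower.horizonL2_horizonProfile_eq_det` (p672188):

* `HorizonTower.horizonL2_horizonProfile_eq_zero_iff` — for `l ≥ 2` and `x ≠ 0`: `horizonL2 (horizonProfile l H 0) 0 x = 0 ↔
  ⟪∇H(x), ∇G(x) × x⟫ = 0` (`G = ‖∇H‖²`): the order-two horizon law of a single-degree profile vanishes exactly where the Jacobian of
  `x ↦ (H, ‖∇H‖², ‖x‖²)` does;
* `HorizonTower.horizonZonality_of_detZonal` — degree by degree: «det-zonality at degree `l`» ⇒ the `l`-cell of `HorizonZonalitySingleDegree`;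
* ★ `HorizonTower.horizonZonalitySingleDegree_of_detZonal` — **`HorizonZonalitySingleDegree` (the line's typed obstruction, ALL `l`, BY NAME)
  follows from the purely algebraic statement «every smooth degree-`l` homogeneous harmonic `H` (`l ≥ 2`) with `⟪∇H, ∇|∇H|² × x⟫ ≡ 0` on
  `ℝ³ ∖ {0}` has the zonal form»** (ns-wall-crit-1's V9-P4 price in kernel form: no vector calculus is left in the conjecture; what remains
  is the transnormal/isoparametric classification of spherical harmonics on `S²`, eng-7 g3's L2-IDENTITY.md §3(b));
* `HorizonTower.cubicHE3_basisFive`, ★ `HorizonTower.horizonL2Tetrahedral` — the TABLE CELL `HorizonL2Tetrahedral` of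
  `ThreadingFluxHorizonTowerDefs.lean` BY NAME: `𝔏₂[U_{xyz}](x) = 80 (x²−y²)(x²−z²)(y²−z²)/‖x‖⁶` (the tetrahedral cubic `xyz = B₅ = cubicHE3 e₅`
  threads at order two), from the identification `CubicCert.horizonL2_horizonProfile_cubicHE3` (p672708).

HONEST LABEL: reductions/instances of typed objects of one crux idea; `HorizonZonalitySingleDegree` itself (l ≥ 4), `HorizonTowerZonality`,
`PoloidalLiouville` (1222), `UnthreadedRigidity` (27585) and NS regularity remain OPEN and untouched; information-grade for W1/W2 (movement 0).
[cite: MajdaBertozziCUP2002, §1.1 (vector identities)]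
-/

-- the summit and its single problem share the name (D-0017 nested layout)
set_option linter.dupNamespace false

noncomputable section

open Set Function Filter Topology
open scoped Topology RealInnerProductSpace
open Literature.Analysis.FluidPDE

namespace Summit.NavierStokesRegularity.NavierStokesRegularity.Theorems.PoloidalLiouville.HorizonTower

/-! ### `𝔏₂ = 0 ↔ det = 0` and the reduction of `HorizonZonalitySingleDegree` -/

section Reduction

variable {l : ℕ} {H : E3 → ℝ}

/-- **`𝔏₂[U_H](x) = 0 ↔ det(∇H(x), ∇G(x), x) = 0`** for `x ≠ 0`, `l ≥ 2` (`G = ‖∇H‖²`; the prefactor `−4(l−1)(l+2)/‖x‖^{3(l−1)}` of the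
closed-form law does not vanish). -/
theorem horizonL2_horizonProfile_eq_zero_iff (hl : 2 ≤ l) (hH : ContDiff ℝ (⊤ : ℕ∞) H)
    (hhom : ∀ (c : ℝ) (y : E3), H (c • y) = c ^ l * H y) (hharm : ∀ y, Laplacian.laplacian H y = 0)
    {x : E3} (hx : x ≠ 0) :
    horizonL2 (horizonProfile l H 0) 0 x = 0
      ↔ ⟪gradient H x, cross (gradient (fun w : E3 => ‖gradient H w‖ ^ 2) x) x⟫ = 0 := by
  rw [horizonL2_horizonProfile_eq_det (le_trans (by norm_num) hl) hH hhom hharm hx]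
  have hr : ‖x‖ ^ (3 * (l - 1)) ≠ 0 := pow_ne_zero _ (norm_ne_zero_iff.2 hx)
  have hκ : -(4 * (((l : ℝ) - 1) * (l + 2))) ≠ 0 := by
    have h1 : ((l : ℝ) - 1) ≠ 0 := by
      have : (2 : ℝ) ≤ l := by exact_mod_cast hl
      linarith
    have h2 : ((l : ℝ) + 2) ≠ 0 := by positivity
    simp [h1, h2]
  rw [div_eq_zero_iff, mul_eq_zero]
  constructor
  · rintro (h | h)
    · rcases h with h | h
      · exact absurd h hκ
      · exact h
    · exact absurd h hr
  · intro h
    exact Or.inl (Or.inr h)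

variable (l) in
/-- **Degree by degree: det-zonality ⇒ horizon zonality.**  If every smooth degree-`l` homogeneous harmonic `H` with
`⟪∇H, ∇‖∇H‖² × x⟫ ≡ 0` off the origin has the zonal form, then so does every such `H` whose horizon profile is annihilated by `𝔏₂`
(the `l`-cell of `HorizonZonalitySingleDegree`). -/
theorem horizonZonality_of_detZonal (hl : 2 ≤ l)
    (hdet : ∀ H : E3 → ℝ, ContDiff ℝ (⊤ : ℕ∞) H → (∀ (c : ℝ) (y : E3), H (c • y) = c ^ l * H y) →
      (∀ y, Laplacian.laplacian H y = 0) →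
      (∀ x : E3, x ≠ 0 → ⟪gradient H x, cross (gradient (fun w : E3 => ‖gradient H w‖ ^ 2) x) x⟫ = 0) →
      ∃ (a : E3) (g : ℝ → ℝ), a ≠ 0 ∧ ∀ y : E3, y ≠ 0 → H y = ‖y‖ ^ l * g (inner ℝ a y / ‖y‖))
    (H : E3 → ℝ) (hH : ContDiff ℝ (⊤ : ℕ∞) H) (hhom : ∀ (c : ℝ) (y : E3), H (c • y) = c ^ l * H y)
    (hharm : ∀ y, Laplacian.laplacian H y = 0) (hL2 : ∀ x : E3, x ≠ 0 → horizonL2 (horizonProfile l H 0) 0 x = 0) :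
    ∃ (a : E3) (g : ℝ → ℝ), a ≠ 0 ∧ ∀ y : E3, y ≠ 0 → H y = ‖y‖ ^ l * g (inner ℝ a y / ‖y‖) :=
  hdet H hH hhom hharm fun x hx => (horizonL2_horizonProfile_eq_zero_iff hl hH hhom hharm hx).1 (hL2 x hx)

/-- ★ **`HorizonZonalitySingleDegree` ⟸ det-zonality (all degrees), BY NAME.**  The line's typed obstruction
`HorizonTower.HorizonZonalitySingleDegree` follows from the first-order algebraic statement: for every `l ≥ 2`, every smooth degree-`l`
homogeneous harmonic `H` with `⟪∇H(x), ∇‖∇H‖²(x) × x⟫ = 0` for all `x ≠ 0` has the zonal form `H(y) = ‖y‖^l g(⟪a,y⟫/‖y‖)`.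
(No vector calculus left: the five nested curls of `𝔏₂` are discharged by `horizonL2_horizonProfile_eq_det`.) -/
theorem horizonZonalitySingleDegree_of_detZonal
    (hdet : ∀ (l : ℕ) (H : E3 → ℝ), 2 ≤ l → ContDiff ℝ (⊤ : ℕ∞) H → (∀ (c : ℝ) (y : E3), H (c • y) = c ^ l * H y) →
      (∀ y, Laplacian.laplacian H y = 0) →
      (∀ x : E3, x ≠ 0 → ⟪gradient H x, cross (gradient (fun w : E3 => ‖gradient H w‖ ^ 2) x) x⟫ = 0) →
      ∃ (a : E3) (g : ℝ → ℝ), a ≠ 0 ∧ ∀ y : E3, y ≠ 0 → H y = ‖y‖ ^ l * g (inner ℝ a y / ‖y‖)) :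
    HorizonZonalitySingleDegree :=
  fun l H hl hH hhom hharm hL2 =>
    horizonZonality_of_detZonal l hl (fun K hK hKhom hKharm hKdet => hdet l K hl hK hKhom hKharm hKdet) H hH hhom hharm hL2

/-- Conversely, pointwise: where `det(∇H, ∇G, x)` vanishes, so does `𝔏₂[U_H]` (`l ≥ 1`, `x ≠ 0`). -/
theorem horizonL2_horizonProfile_eq_zero_of_det (hl : 1 ≤ l) (hH : ContDiff ℝ (⊤ : ℕ∞) H)
    (hhom : ∀ (c : ℝ) (y : E3), H (c • y) = c ^ l * H y) (hharm : ∀ y, Laplacian.laplacian H y = 0)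
    {x : E3} (hx : x ≠ 0) (hdet : ⟪gradient H x, cross (gradient (fun w : E3 => ‖gradient H w‖ ^ 2) x) x⟫ = 0) :
    horizonL2 (horizonProfile l H 0) 0 x = 0 := by
  rw [horizonL2_horizonProfile_eq_det hl hH hhom hharm hx, hdet, mul_zero, zero_div]

end Reduction

/-! ### The table cell `HorizonL2Tetrahedral` -/

/-- The tetrahedral cubic `y ↦ y₀y₁y₂` is `B₅ = cubicHE3 e₅` of the basis of record. -/
theorem cubicHE3_basisFive : (fun y : E3 => y 0 * y 1 * y 2) = CubicCert.cubicHE3 ![0, 0, 0, 0, 1, 0, 0] := by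
  funext y
  simp [CubicCert.cubicHE3, CubicCert.cubicH]

-- `horizonNumerator` is a 450-term polynomial: default recursion depth is too small for `simp`/`ring` on it
set_option maxRecDepth 8192 in
/-- ★ **The table cell `HorizonL2Tetrahedral` BY NAME**: for the tetrahedral cubic `H = xyz` (which escapes the far-field quadrupole law),
`𝔏₂[U_H](x) = 80 (x²−y²)(x²−z²)(y²−z²)/‖x‖⁶` off the origin — the horizon law threads it at order two.  From the identification
`CubicCert.horizonL2_horizonProfile_cubicHE3` (p672708) at `a = e₅`. -/
theorem horizonL2Tetrahedral : HorizonL2Tetrahedral := by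
  intro x hx
  have hr : ‖x‖ ^ 6 ≠ 0 := pow_ne_zero _ (norm_ne_zero_iff.2 hx)
  rw [cubicHE3_basisFive, eq_div_iff hr, mul_comm, CubicCert.horizonL2_horizonProfile_cubicHE3 _ hx]
  simp [CubicCert.horizonNumerator]
  ring

end Summit.NavierStokesRegularity.NavierStokesRegularity.Theorems.PoloidalLiouville.HorizonTower

end
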